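import Literature.ModelTheory.ExponentialFields.OMinimalGenericSmoothness
import Literature.ModelTheory.ExponentialFields.OMinimalGoodDirections
import Literature.ModelTheory.ExponentialFields.OMinimalDimensionCorollaries
import Literature.ModelTheory.ExponentialFields.OMinimalFibreBounds
import Literature.ModelTheory.ExponentialFields.RealFieldExpansionBridge
import Mathlib.Analysis.Calculus.ContDiff.Basic
import HarnessLib

/-!
# The `C^k` locus of a definable family over an o-minimal expansion of the real field (van den Dries Ch. 7 (3.2); Bhardwaj–van den Dries 2022, App. A)

Topic `Literature/ModelTheory/ExponentialFields`; infrastructure in the cone of the named fact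
`PilaWilkie2006_thm_1_8` (for Bhardwaj–van den Dries 2022, Cor. 6.4: *"`V₀ ⋐ U` such that
`f` is of class `C^k` on `V₀`"*, needed uniformly in parameters).  From the tree's generic
`C¹` smoothness (`exists_isClosed_dim_lt_hasC1PartialsOn_compl`) and its real form
(`HasC1PartialsOn.contDiffOn_real`), both in the `orderedRing`-expansion convention, reached
through the bridge `exists_orderedRing_expansion`:

* `contDiffOn_of_partials_words` — `C^{k+1}` (Fréchet, `ContDiffOn`) from `C¹` data on all
  iterated partials of order `≤ k` (recursion on `contDiffOn_succ_iff_fderiv_of_isOpen`);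
* `exists_wordPartials` — canonical definable iterated partials `D_w` of a definable function;
* first-order encodings: quantifier blocks over tuples in predicate form
  (`definable_setOf_exists_block'`, `definable_setOf_forall_block'`; the set forms are Mathlib's
  `Definable.exists_of_finite` / `Definable.forall_of_finite`), `definable_setOf_forall_box_mem`,
  `definable_setOf_continuousOn_box` (continuity on a box is first order),
  `definableFun_comp_append`, `hasPartialDerivAt_append_iff`,
  `interior_biUnion_eq_empty_of_definable`;
* **`exists_contDiffOn_locus_family`** (expansion convention) and
  **`exists_contDiffOn_locus_family_of_field`** (graphs-of-`+`,`·` convention): for a definable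
  `F : ℝ^{p+n} → ℝ`, `n, k ≥ 1`, a definable `G ⊆ ℝ^{p+n}` with open fibres `G_v` of
  complement with empty interior on which `y ↦ F(v,y)` is `ContDiffOn ℝ k`.

Nothing here is a named fact; no definitions.

## References

* L. van den Dries, *Tame topology and o-minimal structures*, CUP 1998, Ch. 7, (3.2)–(3.3).
  [Dries1998]
* N. Bhardwaj, L. van den Dries, *On the Pila–Wilkie theorem*, Expo. Math. 40 (2022),
  Appendix A ("C^k-maps"). [BhardwajVanDenDries2022]
-/

noncomputable section

open Set FirstOrder FirstOrder.Language Filter Topology Function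

namespace Literature.ModelTheory.ExponentialFields

/-! ### From `C¹` partials of all iterated partials to `C^k` (Fréchet) -/

section CkFromC1

variable {L : FirstOrder.Language.{0, 0}} [L.Structure ℝ]
  (φ : Language.orderedRing →ᴸ L) [φ.IsExpansionOn ℝ]

include φ in
/-- **`C^{k+1}` from `C¹` data on all iterated partials** (the recursion behind "continuous
partial derivatives of all orders `≤ k+1` ⇒ `C^{k+1}`" over an o-minimal expansion of the real
field, where the tree's `HasC1PartialsOn.contDiffOn_real` is the first step): let `E_w` (`w` a
word of coordinate directions) be definable functions on `ℝ^n` such that on an open `B`, for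
every word `w` of length `≤ k` and every `i`, `E_{i :: w}` is a continuous `i`-th partial of
`E_w`; then `E_{[]}` is `ContDiffOn ℝ (k+1)` on `B`. [folklore] -/
theorem contDiffOn_of_partials_words (hO : L.IsOMinimal ℝ) {n : ℕ} {B : Set (Fin n → ℝ)} (hB : IsOpen B) :
    ∀ (k : ℕ) (E : List (Fin n) → (Fin n → ℝ) → ℝ),
      (∀ w, (univ : Set ℝ).DefinableFun L (E w)) →
      (∀ w : List (Fin n), w.length ≤ k → ∀ i,
        (∀ y ∈ B, HasPartialDerivAt (E w) i (E (i :: w) y) y) ∧ ContinuousOn (E (i :: w)) B) →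
      ContDiffOn ℝ ((k + 1 : ℕ) : WithTop ℕ∞) (E []) B := by
  intro k
  induction k with
  | zero =>
    intro E hE hC
    have h1 : HasC1PartialsOn (E []) B := fun i =>
      ⟨E [i], (hC [] le_rfl i).1, (hC [] le_rfl i).2⟩
    exact_mod_cast h1.contDiffOn_real φ hO (hE []) hB
  | succ k ih =>
    intro E hE hC
    -- first order: `C¹` with derivative `Σ_i E_[i] • proj_i`
    have h1 : HasC1PartialsOn (E []) B := fun i =>
      ⟨E [i], (hC [] (Nat.zero_le _) i).1, (hC [] (Nat.zero_le _) i).2⟩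
    obtain ⟨g, hg, -, hlin⟩ := h1.exists_hasLinDerivAt φ hO (hE []) hB
    have hgE : ∀ i, ∀ y ∈ B, g i y = E [i] y := fun i y hy =>
      (hg i y hy).unique ((hC [] (Nat.zero_le _) i).1 y hy)
    have hfd : ∀ y ∈ B, HasFDerivAt (E []) (∑ i, E [i] y • (ContinuousLinearMap.proj i : (Fin n → ℝ) →L[ℝ] ℝ)) y := by
      intro y hy
      have h := (hlin y hy).hasFDerivAt_real
      have heq : (∑ i, g i y • (ContinuousLinearMap.proj i : (Fin n → ℝ) →L[ℝ] ℝ)) =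
          ∑ i, E [i] y • (ContinuousLinearMap.proj i : (Fin n → ℝ) →L[ℝ] ℝ) :=
        Finset.sum_congr rfl fun i _ => by rw [hgE i y hy]
      rw [heq] at h
      exact h
    have hdiff : DifferentiableOn ℝ (E []) B := fun y hy => (hfd y hy).differentiableAt.differentiableWithinAt
    -- the partials are `C^{k+1}` by induction, applied to the shifted families
    have hpart : ∀ i, ContDiffOn ℝ ((k + 1 : ℕ) : WithTop ℕ∞) (E [i]) B := by
      intro i
      have h := ih (fun w => E (w ++ [i])) (fun w => hE _) fun w hw j => ?_
      · simpa using h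
      · have h' := hC (w ++ [i]) (by simp; omega) j
        simpa using h'
    rw [show (((k + 1 + 1 : ℕ)) : WithTop ℕ∞) = ((k + 1 : ℕ) : WithTop ℕ∞) + 1 by push_cast; ring,
      contDiffOn_succ_iff_fderiv_of_isOpen hB]
    refine ⟨hdiff, fun h => absurd h (by simp), ?_⟩
    have heq : EqOn (fderiv ℝ (E [])) (fun y => ∑ i, E [i] y • (ContinuousLinearMap.proj i : (Fin n → ℝ) →L[ℝ] ℝ)) B :=
      fun y hy => (hfd y hy).fderiv
    refine ContDiffOn.congr ?_ heq
    exact ContDiffOn.sum fun i _ => (hpart i).smul contDiffOn_const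

end CkFromC1

/-! ### Canonical definable iterated partials of a definable function -/

section WordPartials

variable {L : FirstOrder.Language.{0, 0}} [L.Structure ℝ]
  (φ : Language.orderedRing →ᴸ L) [φ.IsExpansionOn ℝ]

include φ in
/-- **Canonical definable iterated partials**: for a definable `F : ℝ^N → ℝ` there are
definable functions `D_w` (`w` a word of coordinate directions) with `D_{[]} = F` and
`D_{i :: w}(x) = (∂ D_w/∂x_i)(x)` wherever this partial derivative exists (the tree's
`exists_definableFun_partial`, iterated). [cite: Dries1998, Ch. 7 (3.2)] -/
theorem exists_wordPartials {N : ℕ} {F : (Fin N → ℝ) → ℝ} (hF : (univ : Set ℝ).DefinableFun L F) :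
    ∃ D : List (Fin N) → (Fin N → ℝ) → ℝ, D [] = F ∧ (∀ w, (univ : Set ℝ).DefinableFun L (D w)) ∧
      ∀ (i : Fin N) (w : List (Fin N)) (x : Fin N → ℝ) (d : ℝ),
        HasPartialDerivAt (D w) i d x → D (i :: w) x = d := by
  classical
  choose g hg using fun (H : {H : (Fin N → ℝ) → ℝ // (univ : Set ℝ).DefinableFun L H}) (i : Fin N) =>
    exists_definableFun_partial φ H.2 i
  let D' : List (Fin N) → {H : (Fin N → ℝ) → ℝ // (univ : Set ℝ).DefinableFun L H} := fun w =>
    w.foldr (fun i H => ⟨g H i, (hg H i).1⟩) ⟨F, hF⟩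
  refine ⟨fun w => (D' w).1, rfl, fun w => (D' w).2, fun i w x d hd => ?_⟩
  show (g (D' w) i) x = d
  exact (hg (D' w) i).2 x d hd

end WordPartials

/-! ### Quantifier blocks over tuples -/

section Blocks

variable {L : Language} [L.Structure ℝ] {α β : Type} [Finite β]

-- The set forms `{u | ∃ y, Sum.elim u y ∈ S}` / `{u | ∀ y, Sum.elim u y ∈ S}` are Mathlib's
-- `Definable.exists_of_finite` / `Definable.forall_of_finite`; only the predicate forms are kept.

/-- `∃`-block, predicate form (from Mathlib's `Definable.exists_of_finite`). [folklore] -/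
theorem definable_setOf_exists_block' {P : (α → ℝ) → (β → ℝ) → Prop}
    (h : (univ : Set ℝ).Definable L {g : α ⊕ β → ℝ | P (fun i => g (Sum.inl i)) (fun j => g (Sum.inr j))}) :
    (univ : Set ℝ).Definable L {u : α → ℝ | ∃ y : β → ℝ, P u y} := by
  have h' := h.exists_of_finite
  convert h' using 1
  ext u; simp

/-- `∀`-block, predicate form (from Mathlib's `Definable.forall_of_finite`). [folklore] -/
theorem definable_setOf_forall_block' {P : (α → ℝ) → (β → ℝ) → Prop}
    (h : (univ : Set ℝ).Definable L {g : α ⊕ β → ℝ | P (fun i => g (Sum.inl i)) (fun j => g (Sum.inr j))}) :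
    (univ : Set ℝ).Definable L {u : α → ℝ | ∀ y : β → ℝ, P u y} := by
  have h' := h.forall_of_finite
  convert h' using 1
  ext u; simp

end Blocks

/-! ### First-order conditions on boxes: membership and continuity -/

section BoxConditions

variable {L : Language} [L.Structure ℝ]

/-- `∀ z ∈ box(a,b), (v, z) ∈ A` is a definable condition on `(v, a, b)`. [folklore] -/
theorem definable_setOf_forall_box_mem {p n : ℕ}
    (hlt : (univ : Set ℝ).Definable L {v : Fin 2 → ℝ | v 0 < v 1})
    {A : Set (Fin (p + n) → ℝ)} (hA : (univ : Set ℝ).Definable L A) :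
    (univ : Set ℝ).Definable L {g : Fin p ⊕ (Fin n ⊕ Fin n) → ℝ |
      ∀ z : Fin n → ℝ, (∀ j, g (Sum.inr (Sum.inl j)) < z j ∧ z j < g (Sum.inr (Sum.inr j))) →
        (Fin.append (fun i => g (Sum.inl i)) z :) ∈ A} := by
  -- the relation in the variables `(g, z)`
  set κ : Fin (p + n) → (Fin p ⊕ (Fin n ⊕ Fin n)) ⊕ Fin n :=
    Fin.addCases (fun i => Sum.inl (Sum.inl i)) (fun j => Sum.inr j) with hκ
  have happ : ∀ h : (Fin p ⊕ (Fin n ⊕ Fin n)) ⊕ Fin n → ℝ,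
      (h ∘ κ) = Fin.append (fun i => h (Sum.inl (Sum.inl i))) (fun j => h (Sum.inr j)) := by
    intro h; funext l
    refine Fin.addCases (fun i => ?_) (fun j => ?_) l <;> simp [hκ]
  have hmem : (univ : Set ℝ).Definable L {h : (Fin p ⊕ (Fin n ⊕ Fin n)) ⊕ Fin n → ℝ |
      (Fin.append (fun i => h (Sum.inl (Sum.inl i))) (fun j => h (Sum.inr j)) :) ∈ A} := by
    have h := hA.preimage_comp κ
    convert h using 1
    ext h; show _ ↔ (h ∘ κ) ∈ A; rw [happ]; rfl
  have hbox : (univ : Set ℝ).Definable L {h : (Fin p ⊕ (Fin n ⊕ Fin n)) ⊕ Fin n → ℝ |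
      ∀ j, h (Sum.inl (Sum.inr (Sum.inl j))) < h (Sum.inr j) ∧ h (Sum.inr j) < h (Sum.inl (Sum.inr (Sum.inr j)))} := by
    have h := definable_iInter_of_finite (L := L) (A := (univ : Set ℝ))
      (f := fun j : Fin n => {h : (Fin p ⊕ (Fin n ⊕ Fin n)) ⊕ Fin n → ℝ |
        h (Sum.inl (Sum.inr (Sum.inl j))) < h (Sum.inr j) ∧ h (Sum.inr j) < h (Sum.inl (Sum.inr (Sum.inr j)))})
      (fun j => definable_setOf_and (definable_setOf_lt hlt (definableFun_proj _) (definableFun_proj _))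
        (definable_setOf_lt hlt (definableFun_proj _) (definableFun_proj _)))
    convert h using 1
    ext h; simp only [mem_iInter, mem_setOf_eq]
  have himp := hbox.compl.union hmem
  have h := himp.forall_of_finite (α := Fin p ⊕ (Fin n ⊕ Fin n)) (β := Fin n)
  convert h using 1
  ext g
  simp only [mem_setOf_eq, mem_union, mem_compl_iff, Sum.elim_inl, Sum.elim_inr]
  refine forall_congr' fun z => ?_
  exact imp_iff_not_or



/-- Evaluating a definable `g : ℝ^{p+n} → ℝ` at `(q e, T e)` for definable maps `q`, `T`.
[folklore] -/
theorem definableFun_comp_append {p n : ℕ} {g : (Fin (p + n) → ℝ) → ℝ}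
    (hg : (univ : Set ℝ).DefinableFun L g) {γ : Type} [Finite γ]
    {q : (γ → ℝ) → Fin p → ℝ} {T : (γ → ℝ) → Fin n → ℝ}
    (hq : (univ : Set ℝ).DefinableMap L q) (hT : (univ : Set ℝ).DefinableMap L T) :
    (univ : Set ℝ).DefinableFun L (fun e => g (Fin.append (q e) (T e))) := by
  have hmap : (univ : Set ℝ).DefinableMap L (fun e : γ → ℝ => (Fin.append (q e) (T e) : Fin (p + n) → ℝ)) := by
    intro l
    refine Fin.addCases (fun i => ?_) (fun j => ?_) l
    · simp only [Fin.append_left]; exact hq i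
    · simp only [Fin.append_right]; exact hT j
  exact hg.comp hmap

/-- **Continuity on a box is first order**: `z ↦ g(v, z)` continuous on `box(a, b)` is a
definable condition on `(v, a, b)` for a definable `g` (`ε`–`δ` in the sup metric).
[folklore] -/
theorem definable_setOf_continuousOn_box {p n : ℕ}
    (hadd : (univ : Set ℝ).Definable L {v : Fin 3 → ℝ | v 0 + v 1 = v 2})
    (hmul : (univ : Set ℝ).Definable L {v : Fin 3 → ℝ | v 0 * v 1 = v 2})
    {g : (Fin (p + n) → ℝ) → ℝ} (hg : (univ : Set ℝ).DefinableFun L g) :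
    (univ : Set ℝ).Definable L {u : Fin p ⊕ (Fin n ⊕ Fin n) → ℝ |
      ContinuousOn (fun z : Fin n → ℝ => g (Fin.append (fun i => u (Sum.inl i)) z))
        (Set.pi univ fun j => Ioo (u (Sum.inr (Sum.inl j))) (u (Sum.inr (Sum.inr j))))} := by
  have hlt := definable_lt_of_field hadd hmul
  -- the nested first-order form, variables `u; z₀; ε; δ; z`
  set P : (Fin p ⊕ (Fin n ⊕ Fin n) → ℝ) → Prop := fun u =>
    ∀ z₀ : Fin n → ℝ, (∀ j, u (Sum.inr (Sum.inl j)) < z₀ j ∧ z₀ j < u (Sum.inr (Sum.inr j))) →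
      ∀ ε : ℝ, 0 < ε → ∃ δ : ℝ, 0 < δ ∧ ∀ z : Fin n → ℝ,
        (∀ j, u (Sum.inr (Sum.inl j)) < z j ∧ z j < u (Sum.inr (Sum.inr j))) →
        (∀ j, z j - z₀ j < δ ∧ z₀ j - z j < δ) →
          g (Fin.append (fun i => u (Sum.inl i)) z) - g (Fin.append (fun i => u (Sum.inl i)) z₀) < ε ∧
          g (Fin.append (fun i => u (Sum.inl i)) z₀) - g (Fin.append (fun i => u (Sum.inl i)) z) < ε with hP
  have key : ∀ u, ContinuousOn (fun z : Fin n → ℝ => g (Fin.append (fun i => u (Sum.inl i)) z))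
      (Set.pi univ fun j => Ioo (u (Sum.inr (Sum.inl j))) (u (Sum.inr (Sum.inr j)))) ↔ P u := by
    intro u
    rw [Metric.continuousOn_iff]
    simp only [hP, Set.mem_pi, Set.mem_univ, Set.mem_Ioo, forall_const]
    constructor
    · intro H z₀ hz₀ ε hε
      obtain ⟨δ, hδ, hH⟩ := H z₀ hz₀ ε hε
      refine ⟨δ, hδ, fun z hz hzδ => ?_⟩
      have hd : dist z z₀ < δ := by
        rw [dist_pi_lt_iff hδ]; intro j; rw [Real.dist_eq, abs_sub_lt_iff]; exact hzδ j
      have := hH z hz hd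
      rw [Real.dist_eq, abs_sub_lt_iff] at this
      exact this
    · intro H z₀ hz₀ ε hε
      obtain ⟨δ, hδ, hH⟩ := H z₀ hz₀ ε hε
      refine ⟨δ, hδ, fun z hz hd => ?_⟩
      rw [Real.dist_eq, abs_sub_lt_iff]
      apply hH z hz
      intro j
      rw [dist_pi_lt_iff hδ] at hd
      have := hd j
      rw [Real.dist_eq, abs_sub_lt_iff] at this
      exact this
  have hPset : {u | ContinuousOn (fun z : Fin n → ℝ => g (Fin.append (fun i => u (Sum.inl i)) z))
      (Set.pi univ fun j => Ioo (u (Sum.inr (Sum.inl j))) (u (Sum.inr (Sum.inr j))))} = {u | P u} := by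
    ext u; exact key u
  rw [hPset, hP]
  -- index types: I := Fin p ⊕ (Fin n ⊕ Fin n); levels adjoin z₀ : Fin n, ε : Unit, δ : Unit, z : Fin n
  -- level 1: ∀ z₀-block
  apply definable_setOf_forall_block' (β := Fin n)
  -- level 2: implication, then ∀ ε (single)
  refine definable_setOf_imp ?_ ?_
  · exact definable_iInter_of_finite (L := L) (A := (univ : Set ℝ))
      (f := fun j : Fin n => {w : (Fin p ⊕ (Fin n ⊕ Fin n)) ⊕ Fin n → ℝ |
        w (Sum.inl (Sum.inr (Sum.inl j))) < w (Sum.inr j) ∧ w (Sum.inr j) < w (Sum.inl (Sum.inr (Sum.inr j)))})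
      (fun j => definable_setOf_and (definable_setOf_lt hlt (definableFun_proj _) (definableFun_proj _))
        (definable_setOf_lt hlt (definableFun_proj _) (definableFun_proj _))) |> fun h => by
      convert h using 1; ext w; simp only [mem_iInter, mem_setOf_eq]
  apply definable_setOf_forall
  refine definable_setOf_imp (definable_setOf_lt hlt (definableFun_const' _ _) (definableFun_proj _)) ?_
  -- level 3: ∃ δ (single)
  apply definable_setOf_exists
  refine definable_setOf_and (definable_setOf_lt hlt (definableFun_const' _ _) (definableFun_proj _)) ?_
  -- level 4: ∀ z-block
  apply definable_setOf_forall_block' (β := Fin n)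
  -- the matrix, variables `e : ((((I ⊕ Fin n) ⊕ Unit) ⊕ Unit) ⊕ Fin n) → ℝ`
  -- coordinates
  have hv : (univ : Set ℝ).DefinableMap L (fun e : ((((Fin p ⊕ (Fin n ⊕ Fin n)) ⊕ Fin n) ⊕ Unit) ⊕ Unit) ⊕ Fin n → ℝ =>
      fun i : Fin p => e (Sum.inl (Sum.inl (Sum.inl (Sum.inl (Sum.inl i)))))) := fun i => definableFun_proj _
  have hz₀ : (univ : Set ℝ).DefinableMap L (fun e : ((((Fin p ⊕ (Fin n ⊕ Fin n)) ⊕ Fin n) ⊕ Unit) ⊕ Unit) ⊕ Fin n → ℝ =>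
      fun j : Fin n => e (Sum.inl (Sum.inl (Sum.inl (Sum.inr j))))) := fun j => definableFun_proj _
  have hz : (univ : Set ℝ).DefinableMap L (fun e : ((((Fin p ⊕ (Fin n ⊕ Fin n)) ⊕ Fin n) ⊕ Unit) ⊕ Unit) ⊕ Fin n → ℝ =>
      fun j : Fin n => e (Sum.inr j)) := fun j => definableFun_proj _
  have hgz := definableFun_comp_append hg hv hz
  have hgz₀ := definableFun_comp_append hg hv hz₀
  refine definable_setOf_imp ?_ (definable_setOf_imp ?_ ?_)
  · exact definable_iInter_of_finite (L := L) (A := (univ : Set ℝ))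
      (f := fun j : Fin n => {e : ((((Fin p ⊕ (Fin n ⊕ Fin n)) ⊕ Fin n) ⊕ Unit) ⊕ Unit) ⊕ Fin n → ℝ |
        e (Sum.inl (Sum.inl (Sum.inl (Sum.inl (Sum.inr (Sum.inl j)))))) < e (Sum.inr j) ∧
        e (Sum.inr j) < e (Sum.inl (Sum.inl (Sum.inl (Sum.inl (Sum.inr (Sum.inr j))))))})
      (fun j => definable_setOf_and (definable_setOf_lt hlt (definableFun_proj _) (definableFun_proj _))
        (definable_setOf_lt hlt (definableFun_proj _) (definableFun_proj _))) |> fun h => by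
      convert h using 1; ext e; simp only [mem_iInter, mem_setOf_eq]
  · exact definable_iInter_of_finite (L := L) (A := (univ : Set ℝ))
      (f := fun j : Fin n => {e : ((((Fin p ⊕ (Fin n ⊕ Fin n)) ⊕ Fin n) ⊕ Unit) ⊕ Unit) ⊕ Fin n → ℝ |
        e (Sum.inr j) - e (Sum.inl (Sum.inl (Sum.inl (Sum.inr j)))) < e (Sum.inl (Sum.inr ())) ∧
        e (Sum.inl (Sum.inl (Sum.inl (Sum.inr j)))) - e (Sum.inr j) < e (Sum.inl (Sum.inr ()))})
      (fun j => definable_setOf_and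
        (definable_setOf_lt hlt (definableFun_sub hadd (definableFun_proj _) (definableFun_proj _)) (definableFun_proj _))
        (definable_setOf_lt hlt (definableFun_sub hadd (definableFun_proj _) (definableFun_proj _)) (definableFun_proj _))) |> fun h => by
      convert h using 1; ext e; simp only [mem_iInter, mem_setOf_eq]
  · exact definable_setOf_and
      (definable_setOf_lt hlt (definableFun_sub hadd hgz hgz₀) (definableFun_proj _))
      (definable_setOf_lt hlt (definableFun_sub hadd hgz₀ hgz) (definableFun_proj _))

end BoxConditions

/-! ### The `C^k` locus of a definable family -/

section SmoothLocus

open Classical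

variable {L : FirstOrder.Language.{0, 0}} [L.Structure ℝ]

/-- Partial derivatives of the fibre function are partial derivatives of the total function in
the corresponding coordinate. [folklore] -/
theorem hasPartialDerivAt_append_iff {p n : ℕ} {H : (Fin (p + n) → ℝ) → ℝ} {v : Fin p → ℝ}
    {y : Fin n → ℝ} {i : Fin n} {d : ℝ} :
    HasPartialDerivAt (fun z : Fin n → ℝ => H (Fin.append v z)) i d y ↔
      HasPartialDerivAt H (Fin.natAdd p i) d (Fin.append v y) := by
  have hsec : (fun t => H (Fin.append v (Function.update y i t))) =
      fun t => H (Function.update (Fin.append v y) (Fin.natAdd p i) t) := by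
    funext t; congr 1; ext l
    refine Fin.addCases (fun a => ?_) (fun j => ?_) l
    · simp only [Fin.append_left]
      rw [Function.update_of_ne]
      · simp
      · intro h
        have := congrArg Fin.val h
        simp at this; omega
    · simp only [Fin.append_right]
      by_cases hj : j = i
      · subst hj; simp
      · rw [Function.update_of_ne hj, Function.update_of_ne]
        · simp
        · intro h; exact hj (Fin.natAdd_inj _ |>.mp h) |> False.elim |> fun x => x
  rw [hasPartialDerivAt_iff, hasPartialDerivAt_iff, hsec]
  simp only [Fin.append_right]

/-- A finite union of definable subsets of `ℝ^n`, `n ≥ 1`, with empty interior has empty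
interior (o-minimal dimension). [folklore] -/
theorem interior_biUnion_eq_empty_of_definable {n : ℕ} (hn : 1 ≤ n) (hO : L.IsOMinimal ℝ)
    (hlt : (univ : Set ℝ).Definable L {v : Fin 2 → ℝ | v 0 < v 1})
    {α : Type*} (s : Finset α) (X : α → Set (Fin n → ℝ))
    (hX : ∀ a ∈ s, (univ : Set ℝ).Definable L (X a)) (hint : ∀ a ∈ s, interior (X a) = ∅) :
    interior (⋃ a ∈ s, X a) = ∅ := by
  have hdim : ∀ a ∈ s, CellDimension.dim L n (X a) < n := by
    intro a ha
    rcases (X a).eq_empty_or_nonempty with h | hne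
    · rw [h, CellDimension.dim_eq_zero_of_forall_not fun ι' C' hC' hsub => ?_]
      · exact hn
      · exact absurd (subset_empty_iff.mp hsub) hC'.nonempty.ne_empty
    · rcases (CellDimension.dim_le (L := L) (X a)).lt_or_eq with h | h
      · exact h
      · have := CellDimension.interior_nonempty_of_dim_eq hO hlt (hX a ha) hne h
        rw [hint a ha] at this
        exact absurd this not_nonempty_empty
  by_contra hne
  have hne' : (interior (⋃ a ∈ s, X a)).Nonempty := nonempty_iff_ne_empty.mpr hne
  have h := CellDimension.dim_eq_of_interior_nonempty (L := L) hlt hne'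
  rw [CellDimension.dim_biUnion_finset hO hlt s X hX] at h
  have : s.sup (fun a => CellDimension.dim L n (X a)) < n := (Finset.sup_lt_iff hn).mpr hdim
  omega

variable (φ : Language.orderedRing →ᴸ L) [φ.IsExpansionOn ℝ]

include φ in
/-- **Generic `C^k` smoothness for definable families, Fréchet form, uniformly** (van den Dries
1998, Ch. 7, (3.2)/(3.3): a definable function is `C^k` off a definable set of smaller
dimension; Bhardwaj–van den Dries 2022, App. A, last subsection on `C^k`-maps: *"`V₀ ⋐ U`
such that `f` is of class `C^k` on `V₀`"*): for a definable `F : ℝ^{p+n} → ℝ`, `n ≥ 1`, and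
`k ≥ 1` there is a definable `G ⊆ ℝ^{p+n}` whose fibres `G_v` are open, with complement of
empty interior, and on which `y ↦ F(v, y)` is `ContDiffOn ℝ k`. (The fibre `G_v` is the set of
points near which all canonical iterated partials of order `< k` of `F(v,·)` have continuous
first partials; `C^k` there by `contDiffOn_of_partials_words`, and the complement is a finite
union of non-`C¹` loci of definable functions, each of empty interior by the tree's
`exists_isClosed_dim_lt_hasC1PartialsOn_compl`.) [cite: Dries1998, Ch. 7 (3.2)]
[cite: BhardwajVanDenDries2022, App. A] -/
theorem exists_contDiffOn_locus_family (hO : L.IsOMinimal ℝ) {p n : ℕ} (hn : 1 ≤ n)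
    {F : (Fin (p + n) → ℝ) → ℝ} (hF : (univ : Set ℝ).DefinableFun L F) (k : ℕ) (hk : 1 ≤ k) :
    ∃ G : Set (Fin (p + n) → ℝ), (univ : Set ℝ).Definable L G ∧
      ∀ v : Fin p → ℝ,
        IsOpen {y : Fin n → ℝ | (Fin.append v y :) ∈ G} ∧
        ContDiffOn ℝ k (fun y => F (Fin.append v y)) {y | (Fin.append v y :) ∈ G} ∧
        interior {y : Fin n → ℝ | (Fin.append v y :) ∈ G}ᶜ = ∅ := by
  have hL := IsRealFieldExpansion.of_expansion φ
  have hadd := hL.definable_add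
  have hmul := hL.definable_mul
  have hlt := definable_lt_of_field hadd hmul
  obtain ⟨D, hD0, hDdef, hDspec⟩ := exists_wordPartials φ hF
  -- words over the fibre coordinates, read in `ℝ^{p+n}`
  set lift : List (Fin n) → List (Fin (p + n)) := fun w => w.map (Fin.natAdd p) with hlift
  -- the sets `A w i = {u | the i-th partial of D_w exists at u and equals D_{i::w}(u)}`
  set A : List (Fin n) → Fin n → Set (Fin (p + n) → ℝ) := fun w i =>
    {u | HasPartialDerivAt (D (lift w)) (Fin.natAdd p i) (D (Fin.natAdd p i :: lift w) u) u} with hA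
  have hAdef : ∀ w i, (univ : Set ℝ).Definable L (A w i) := by
    intro w i
    have h := definable_setOf_hasPartialDerivAt φ (hDdef (lift w)) (Fin.natAdd p i)
    have hmap : (univ : Set ℝ).DefinableMap L
        (fun u : Fin (p + n) → ℝ => (Sum.elim u (fun _ => D (Fin.natAdd p i :: lift w) u) : Fin (p + n) ⊕ Unit → ℝ)) := by
      intro l; cases l with
      | inl l => exact definableFun_proj _
      | inr _ => exact hDdef _
    have h' := h.preimage_map hmap
    convert h' using 1
    ext u
    simp only [hA, mem_setOf_eq, mem_preimage, Sum.elim_inr, Sum.elim_inl]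
  -- the box conditions `T₁ w i` (existence of partials on the box) and `T₂ w i` (continuity)
  set T₁ : List (Fin n) → Fin n → Set (Fin p ⊕ (Fin n ⊕ Fin n) → ℝ) := fun w i =>
    {g | ∀ z : Fin n → ℝ, (∀ j, g (Sum.inr (Sum.inl j)) < z j ∧ z j < g (Sum.inr (Sum.inr j))) →
      (Fin.append (fun a => g (Sum.inl a)) z :) ∈ A w i} with hT₁
  set T₂ : List (Fin n) → Fin n → Set (Fin p ⊕ (Fin n ⊕ Fin n) → ℝ) := fun w i =>
    {g | ContinuousOn (fun z : Fin n → ℝ => D (Fin.natAdd p i :: lift w) (Fin.append (fun a => g (Sum.inl a)) z))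
      (Set.pi univ fun j => Ioo (g (Sum.inr (Sum.inl j))) (g (Sum.inr (Sum.inr j))))} with hT₂
  have hT₁def : ∀ w i, (univ : Set ℝ).Definable L (T₁ w i) := fun w i =>
    definable_setOf_forall_box_mem hlt (hAdef w i)
  have hT₂def : ∀ w i, (univ : Set ℝ).Definable L (T₂ w i) := fun w i =>
    definable_setOf_continuousOn_box hadd hmul (hDdef _)
  -- the good sets
  set Good : List (Fin n) → Set (Fin (p + n) → ℝ) := fun w =>
    {u | ∃ ab : Fin n ⊕ Fin n → ℝ, (∀ j, ab (Sum.inl j) < u (Fin.natAdd p j) ∧ u (Fin.natAdd p j) < ab (Sum.inr j)) ∧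
      ∀ i : Fin n, (Sum.elim (fun a => u (Fin.castAdd n a)) ab : Fin p ⊕ (Fin n ⊕ Fin n) → ℝ) ∈ T₁ w i ∧
        (Sum.elim (fun a => u (Fin.castAdd n a)) ab : Fin p ⊕ (Fin n ⊕ Fin n) → ℝ) ∈ T₂ w i} with hGood
  have hGooddef : ∀ w, (univ : Set ℝ).Definable L (Good w) := by
    intro w
    apply definable_setOf_exists_block' (β := Fin n ⊕ Fin n) (α := Fin (p + n))
    -- reindexing `(u, ab) ↦ (v, a, b)`
    set ι' : Fin p ⊕ (Fin n ⊕ Fin n) → Fin (p + n) ⊕ (Fin n ⊕ Fin n) :=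
      Sum.elim (fun a => Sum.inl (Fin.castAdd n a)) (fun ab => Sum.inr ab) with hι'
    have hre : ∀ g : Fin (p + n) ⊕ (Fin n ⊕ Fin n) → ℝ,
        (g ∘ ι') = Sum.elim (fun a => g (Sum.inl (Fin.castAdd n a))) (fun ab => g (Sum.inr ab)) := by
      intro g; funext l; cases l <;> rfl
    refine definable_setOf_and ?_ ?_
    · exact definable_iInter_of_finite (L := L) (A := (univ : Set ℝ))
        (f := fun j : Fin n => {g : Fin (p + n) ⊕ (Fin n ⊕ Fin n) → ℝ |
          g (Sum.inr (Sum.inl j)) < g (Sum.inl (Fin.natAdd p j)) ∧ g (Sum.inl (Fin.natAdd p j)) < g (Sum.inr (Sum.inr j))})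
        (fun j => definable_setOf_and (definable_setOf_lt hlt (definableFun_proj _) (definableFun_proj _))
          (definable_setOf_lt hlt (definableFun_proj _) (definableFun_proj _))) |> fun h => by
        convert h using 1; ext g; simp only [mem_iInter, mem_setOf_eq]
    · refine definable_iInter_of_finite (L := L) (A := (univ : Set ℝ))
        (f := fun i : Fin n => {g : Fin (p + n) ⊕ (Fin n ⊕ Fin n) → ℝ | (g ∘ ι') ∈ T₁ w i ∧ (g ∘ ι') ∈ T₂ w i})
        (fun i => ((hT₁def w i).preimage_comp ι').inter ((hT₂def w i).preimage_comp ι')) |> fun h => by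
        convert h using 1
        ext g
        simp only [mem_iInter, mem_setOf_eq, hre]
  -- all words of length `< k`
  set G : Set (Fin (p + n) → ℝ) := ⋂ l : Fin k, ⋂ r : Fin l → Fin n, Good (List.ofFn r) with hG
  have hGdef : (univ : Set ℝ).Definable L G :=
    definable_iInter_of_finite fun l => definable_iInter_of_finite fun r => hGooddef _
  refine ⟨G, hGdef, fun v => ?_⟩
  -- the fibre functions
  set E : List (Fin n) → (Fin n → ℝ) → ℝ := fun w y => D (lift w) (Fin.append v y) with hE
  have hE0 : E [] = fun y => F (Fin.append v y) := by
    funext y; simp [hE, hlift, hD0]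
  -- unpacking membership in `Good w`
  have hGood_iff : ∀ w (y : Fin n → ℝ), (Fin.append v y :) ∈ Good w ↔ ∃ a b : Fin n → ℝ,
      (∀ j, a j < y j ∧ y j < b j) ∧ ∀ i : Fin n,
        (∀ z : Fin n → ℝ, (∀ j, a j < z j ∧ z j < b j) → (Fin.append v z :) ∈ A w i) ∧
        ContinuousOn (fun z : Fin n → ℝ => D (Fin.natAdd p i :: lift w) (Fin.append v z))
          (Set.pi univ fun j => Ioo (a j) (b j)) := by
    intro w y
    simp only [hGood, hT₁, hT₂, mem_setOf_eq, Fin.append_right, Fin.append_left, Sum.elim_inl, Sum.elim_inr]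
    constructor
    · rintro ⟨ab, hab, hall⟩
      exact ⟨fun j => ab (Sum.inl j), fun j => ab (Sum.inr j), hab, fun i => hall i⟩
    · rintro ⟨a, b, hab, hall⟩
      refine ⟨Sum.elim a b, hab, fun i => ?_⟩
      simpa using hall i
  -- the fibre of `Good w` is open
  have hGoodopen : ∀ w, IsOpen {y : Fin n → ℝ | (Fin.append v y :) ∈ Good w} := by
    intro w
    rw [isOpen_iff_forall_mem_open]
    intro y hy
    obtain ⟨a, b, hab, hall⟩ := (hGood_iff w y).mp hy
    refine ⟨Set.pi univ fun j => Ioo (a j) (b j), fun y' hy' => ?_, isOpen_set_pi finite_univ fun _ _ => isOpen_Ioo,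
      fun j _ => hab j⟩
    exact (hGood_iff w y').mpr ⟨a, b, fun j => hy' j (mem_univ _), hall⟩
  have hfib_eq : {y : Fin n → ℝ | (Fin.append v y :) ∈ G} =
      ⋂ l : Fin k, ⋂ r : Fin l → Fin n, {y : Fin n → ℝ | (Fin.append v y :) ∈ Good (List.ofFn r)} := by
    ext y; simp [hG]
  have hBopen : IsOpen {y : Fin n → ℝ | (Fin.append v y :) ∈ G} := by
    rw [hfib_eq]
    exact isOpen_iInter_of_finite fun l => isOpen_iInter_of_finite fun r => hGoodopen _
  set B : Set (Fin n → ℝ) := {y : Fin n → ℝ | (Fin.append v y :) ∈ G} with hB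
  have hBsub : ∀ w : List (Fin n), w.length < k → B ⊆ {y | (Fin.append v y :) ∈ Good w} := by
    intro w hw y hy
    have hy' : y ∈ ⋂ l : Fin k, ⋂ r : Fin l → Fin n, {y : Fin n → ℝ | (Fin.append v y :) ∈ Good (List.ofFn r)} := by
      rw [← hfib_eq]; exact hy
    have h := mem_iInter.mp (mem_iInter.mp hy' ⟨w.length, hw⟩) (fun j => w.get j)
    simpa [List.ofFn_get] using h
  refine ⟨hBopen, ?_, ?_⟩
  · ------------------------------------------------------------ `C^k` on the fibre
    obtain ⟨k', rfl⟩ : ∃ k', k = k' + 1 := ⟨k - 1, by omega⟩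
    have h := contDiffOn_of_partials_words φ hO hBopen k' E (fun w => definableFun_comp_append (hDdef _)
      (fun a => definableFun_const' _ _) (fun j => definableFun_proj _)) ?_
    · rw [hE0] at h; exact h
    · intro w hw i
      have hsub := hBsub w (by omega)
      constructor
      · intro y hy
        obtain ⟨a, b, hab, hall⟩ := (hGood_iff w y).mp (hsub hy)
        have hmem := (hall i).1 y hab
        simp only [hA, mem_setOf_eq] at hmem
        have h2 : E (i :: w) y = D (Fin.natAdd p i :: lift w) (Fin.append v y) := by
          simp [hE, hlift]
        rw [h2]
        exact hasPartialDerivAt_append_iff.mpr hmem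
      · intro y hy
        obtain ⟨a, b, hab, hall⟩ := (hGood_iff w y).mp (hsub hy)
        have hc := (hall i).2
        have hy' : y ∈ Set.pi univ (fun j => Ioo (a j) (b j)) := fun j _ => hab j
        have hca : ContinuousAt (fun z : Fin n → ℝ => D (Fin.natAdd p i :: lift w) (Fin.append v z)) y :=
          hc.continuousAt ((isOpen_set_pi finite_univ fun _ _ => isOpen_Ioo).mem_nhds hy')
        have h2 : E (i :: w) = fun z => D (Fin.natAdd p i :: lift w) (Fin.append v z) := by
          funext z; simp [hE, hlift]
        rw [h2]
        exact hca.continuousWithinAt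
  · ------------------------------------------------------------ the complement is small
    have hcompl : Bᶜ = ⋃ lr ∈ (Finset.univ : Finset (Σ l : Fin k, Fin l → Fin n)),
        {y : Fin n → ℝ | (Fin.append v y :) ∈ Good (List.ofFn lr.2)}ᶜ := by
      rw [hfib_eq]
      ext y
      simp only [mem_compl_iff, mem_iInter, mem_iUnion, Finset.mem_univ, true_and, not_forall, Sigma.exists,
        mem_setOf_eq, exists_prop]
    rw [hcompl]
    apply interior_biUnion_eq_empty_of_definable hn hO hlt
    · intro lr _
      exact (definable_fibre_append (hGooddef _) v).compl
    · intro lr _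
      set w := List.ofFn lr.2 with hw
      -- the non-`C¹` locus of the definable `E w`
      have hEdef : (univ : Set ℝ).DefinableFun L (E w) :=
        definableFun_comp_append (hDdef _) (fun a => definableFun_const' _ _) (fun j => definableFun_proj _)
      obtain ⟨Z, hZc, -, hZint, -, hZ⟩ := exists_isClosed_dim_lt_hasC1PartialsOn_compl φ hO (E w) hEdef
      -- `Zᶜ ⊆` the good fibre
      have hsub : Zᶜ ⊆ {y : Fin n → ℝ | (Fin.append v y :) ∈ Good w} := by
        intro y hy
        obtain ⟨a, b, hab, hbox⟩ := exists_box_subset_of_mem_nhds (hZc.isOpen_compl.mem_nhds hy)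
        have hboxZ : (Set.pi univ fun j => Ioo (a j) (b j)) ⊆ Zᶜ := fun z hz => hbox fun j => hz j (mem_univ _)
        have hC1 : HasC1PartialsOn (E w) (Set.pi univ fun j => Ioo (a j) (b j)) := hZ.mono hboxZ
        refine (hGood_iff w y).mpr ⟨a, b, hab, fun i => ?_⟩
        obtain ⟨g, hg, hgc⟩ := hC1 i
        have hcanon : ∀ z ∈ Set.pi univ (fun j => Ioo (a j) (b j)),
            D (Fin.natAdd p i :: lift w) (Fin.append v z) = g z := by
          intro z hz
          exact hDspec (Fin.natAdd p i) (lift w) (Fin.append v z) (g z) (hasPartialDerivAt_append_iff.mp (hg z hz))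
        constructor
        · intro z hz
          have hz' : z ∈ Set.pi univ (fun j => Ioo (a j) (b j)) := fun j _ => hz j
          simp only [hA, mem_setOf_eq]
          rw [hcanon z hz']
          exact hasPartialDerivAt_append_iff.mp (hg z hz')
        · exact hgc.congr fun z hz => hcanon z hz
      have : {y : Fin n → ℝ | (Fin.append v y :) ∈ Good w}ᶜ ⊆ Z := by
        rw [compl_subset_comm]; exact hsub
      exact subset_empty_iff.mp ((interior_mono this).trans (by rw [hZint]))

/-- The same in convention (i): for an o-minimal structure on `ℝ` with the graphs of `+`, `·`
definable. [cite: Dries1998, Ch. 7 (3.2)] -/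
theorem exists_contDiffOn_locus_family_of_field (hO : L.IsOMinimal ℝ)
    (hadd : (univ : Set ℝ).Definable L {v : Fin 3 → ℝ | v 0 + v 1 = v 2})
    (hmul : (univ : Set ℝ).Definable L {v : Fin 3 → ℝ | v 0 * v 1 = v 2})
    {p n : ℕ} (hn : 1 ≤ n) {F : (Fin (p + n) → ℝ) → ℝ} (hF : (univ : Set ℝ).DefinableFun L F)
    (k : ℕ) (hk : 1 ≤ k) :
    ∃ G : Set (Fin (p + n) → ℝ), (univ : Set ℝ).Definable L G ∧
      ∀ v : Fin p → ℝ,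
        IsOpen {y : Fin n → ℝ | (Fin.append v y :) ∈ G} ∧
        ContDiffOn ℝ k (fun y => F (Fin.append v y)) {y | (Fin.append v y :) ∈ G} ∧
        interior {y : Fin n → ℝ | (Fin.append v y :) ∈ G}ᶜ = ∅ := by
  obtain ⟨L', inst, ψ, hψ, hdef, hOm⟩ := exists_orderedRing_expansion (L := L) hadd hmul
  have hF' : (univ : Set ℝ).DefinableFun L' F := by
    unfold Set.DefinableFun at hF ⊢; exact (hdef _).mpr hF
  obtain ⟨G, hGdef, hG⟩ := exists_contDiffOn_locus_family ψ (hOm hO) hn hF' k hk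
  exact ⟨G, (hdef _).mp hGdef, hG⟩

end SmoothLocus


end Literature.ModelTheory.ExponentialFields

end
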